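import Mathlib

/-!
# Eisenstein cokernel classes from CUBIC characters: levels 62, 86, 91 (solo-blind, s25; hodge.md §8.18)

Third file of the series (`SoloBlindEisensteinClass`: 34, 39; `SoloBlindEisensteinClassFamily`: quadratic
characters at 55, 68, 82, 95, 111, 117 and failures at 35, 51, 65).  Same dictionary: `D₁(N)` = `ℚ ⊗`
cyclotomic numbers of level `N` (generators `u_n`, `u_0 = 0`; relations = evenness + non-degenerate
distribution relations, Bass), dihedral cobracket image `span{T(a,b,c) : a+b+c ≡ 0}` (Goncharov),
`k(N) = dim coker`.

The recipe of hodge §8.18.1 for a CUBIC even character `ε mod p` (values in `ℤ[ω]`): writing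
`ε = ε₁ + ω·ε₂` with `ε₁, ε₂ : (ℤ/p)^× → ℤ` (`1 ↦ (1,0)`, `ω ↦ (0,1)`, `ω² ↦ (−1,−1)`), the functional
`E_ε` is well defined over `ℚ(ω)` iff both integer-valued functions `E₁(n) = ε₁(n/d)·[d ∣ n, p ∤ n]` and
`E₂(n) = ε₂(n/d)·[…]` are well defined over `ℚ`, and then `E₁ ∧ J`, `E₂ ∧ J` are two rational cokernel
classes spanning the `{ε, ε̄}`-isotypic plane.  Certified here by `decide +kernel` (no `native_decide`):

* `N = 62 = 31·2`: `ε` = cubic character mod 31 (class of `n` read off `n^10 mod 31 ∈ {1, 25, 5}`),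
  `ε(2) = 1` since `2 = 3^24` is a cube mod 31;
* `N = 86 = 43·2`: cubic character mod 43 (`n^14 mod 43 ∈ {1, 36, 6}`), `ε(2) = 1` since `2^14 ≡ 1`;
* `N = 91 = 7·13`: cubic character mod 7 (`n² mod 7 ∈ {1, 2, 4}`), `ε(13) = ε(−1) = 1`.

In each case both components pass the full certificate (zero at 0, even, every distribution relation
for both primes, three-term annihilation) and are non-zero — so, granting the dictionary,
`k(62), k(86), k(91) ≥ 2`, matching the exact values `k(62) = 2`, `k(86) = 2` found by computation
(hodge §8.18.3) and the lower bound `κ(91) = 2`.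
-/

namespace Summit.KontsevichZagierPeriods.KontsevichZagierPeriods.Theorems.SoloBlindEisensteinClassCubic

/-- `f` (a function of residues `0 ≤ n < N`) is even: `f(−n) = f(n)`. -/
def IsEven (N : ℕ) (f : ℕ → ℤ) : Prop := ∀ n < N, f ((N - n) % N) = f n

/-- `f` respects the non-degenerate distribution relations of level `N` for the prime `q ∣ N`. -/
def RespectsDist (N q : ℕ) (f : ℕ → ℤ) : Prop :=
  ∀ n < N, (q * n) % N ≠ 0 →
    ((List.range q).map (fun t => f ((n + t * (N / q)) % N))).sum = f ((q * n) % N)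

/-- The wedge `E ∧ J` as an antisymmetric kernel on pairs of residues. -/
def wedge (E J : ℕ → ℤ) (a b : ℕ) : ℤ := E a * J b - J a * E b

/-- `Φ` kills every cyclic three-term tensor `T(a,b,c)`, `a + b + c ≡ 0 (mod N)`. -/
def KillsThreeTerm (N : ℕ) (Φ : ℕ → ℕ → ℤ) : Prop :=
  ∀ a < N, ∀ b < N,
    Φ a b + Φ b ((2 * N - a - b) % N) + Φ ((2 * N - a - b) % N) a = 0

/-- Component `i ∈ {1,2}` of a cubic character given by the power map `n ↦ n^e mod p` and the residues
`r₁ ↦ ω`, (the other non-trivial value) `↦ ω²`: `ω⁰ = (1,0)`, `ω = (0,1)`, `ω² = (−1,−1)`. -/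
def cubicComp (p e r₁ : ℕ) (i : ℕ) (m : ℕ) : ℤ :=
  if m % p = 0 then 0
  else if m ^ e % p = 1 then (if i = 1 then 1 else 0)
  else if m ^ e % p = r₁ then (if i = 1 then 0 else 1)
  else -1

/-- The recipe: `E(n) = χ(n/d)` on `{d ∣ n, p ∤ n}`, else 0. -/
def Erec (p d : ℕ) (χ : ℕ → ℤ) (n : ℕ) : ℤ := if n % d = 0 ∧ n % p ≠ 0 then χ (n / d) else 0
/-- The recipe: `J(n) = 1` on `{d ∣ n, p ∤ n}`, else 0. -/
def Jrec (p d : ℕ) (n : ℕ) : ℤ := if n % d = 0 ∧ n % p ≠ 0 then 1 else 0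

/-- The certificate at level `N = p·d` (prime divisors `q₁, q₂` of `N`), with non-vanishing witness
`Φ(d, m·d) = v`. -/
def Certificate (N p d q₁ q₂ m : ℕ) (v : ℤ) (χ : ℕ → ℤ) : Prop :=
  Erec p d χ 0 = 0 ∧ Jrec p d 0 = 0 ∧ IsEven N (Erec p d χ) ∧ IsEven N (Jrec p d) ∧
  RespectsDist N q₁ (Erec p d χ) ∧ RespectsDist N q₂ (Erec p d χ) ∧
  RespectsDist N q₁ (Jrec p d) ∧ RespectsDist N q₂ (Jrec p d) ∧
  KillsThreeTerm N (wedge (Erec p d χ) (Jrec p d)) ∧ wedge (Erec p d χ) (Jrec p d) d (m * d) = v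

/-- Level 62 = 31·2, first component of the cubic character mod 31. -/
theorem certificate62_1 : Certificate 62 31 2 2 31 9 2 (cubicComp 31 10 25 1) := by
  unfold Certificate IsEven RespectsDist KillsThreeTerm; decide +kernel

/-- Level 62 = 31·2, second component of the cubic character mod 31. -/
theorem certificate62_2 : Certificate 62 31 2 2 31 9 1 (cubicComp 31 10 25 2) := by
  unfold Certificate IsEven RespectsDist KillsThreeTerm; decide +kernel

/-- Level 86 = 43·2, first component of the cubic character mod 43. -/
theorem certificate86_1 : Certificate 86 43 2 2 43 9 2 (cubicComp 43 14 36 1) := by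
  unfold Certificate IsEven RespectsDist KillsThreeTerm; decide +kernel

/-- Level 86 = 43·2, second component of the cubic character mod 43. -/
theorem certificate86_2 : Certificate 86 43 2 2 43 9 1 (cubicComp 43 14 36 2) := by
  unfold Certificate IsEven RespectsDist KillsThreeTerm; decide +kernel

/-- Level 91 = 7·13, first component of the cubic character mod 7. -/
theorem certificate91_1 : Certificate 91 7 13 7 13 2 2 (cubicComp 7 2 2 1) := by
  unfold Certificate IsEven RespectsDist KillsThreeTerm; decide +kernel

/-- Level 91 = 7·13, second component of the cubic character mod 7. -/
theorem certificate91_2 : Certificate 91 7 13 7 13 2 1 (cubicComp 7 2 2 2) := by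
  unfold Certificate IsEven RespectsDist KillsThreeTerm; decide +kernel

end Summit.KontsevichZagierPeriods.KontsevichZagierPeriods.Theorems.SoloBlindEisensteinClassCubic
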